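import Literature.Computability.Complexity.ACRealizeOver
import HarnessLib

/-!
# Explicit composition of straight-line programs: `Carries`, `plug`, `layerL`, gate appenders

`ACRealizeOver.lean` / `ACVecOver.lean` provide the calculus `ACRealOver B f d s` /
`ACVecOver B f d s` of constant-depth realizability, whose combinators (`comp`, `prod`,
`ofBlocks`, `gate`, `neg`, …) hide the constructed gate list inside an existential. That is the
right interface for EXISTENCE statements (e.g. the `ACC`-SAT instance `D` of Williams' Thm. 3.2,
`exists_satInstance` in `Williams2014WitnessCheck.lean`), but a MACHINE that has to print the
code of such a circuit (the verifier `B` of Williams 2014, Thm. 3.2, named fact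
`Williams2014_thm_3_2_machineB`; the circuits VALUE, EQUIV of Lemma 3.1) needs the gate list as
DATA with its specification proved about that explicit list. This file provides the explicit
(data-level) counterpart of the calculus, over the same primitives of `CircuitComposition.lean`,
`ACRealize.lean`, `ACRealizeOver.lean` (`reloc`, `shiftWire`, `parBlocks`,
`vals_append_reloc`, `wdepths_append_reloc_le`, …):

* `GateList.Carries gs u f d` — in the program `gs`, the wire `u` exists, carries the Boolean
  function `f` and has `acWeight`-depth `≤ d`; it is stable under appending gates
  (`Carries.append`), which is what makes linear, step-by-step constructions painless;
* `GateList.carries_snoc` — appending one gate; the appenders `andWire`, `orWire`, `notWire`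
  (binary `∧`/`∨` at depth `+ 1`, free `¬`) with their `Carries`, `WF` and basis lemmas;
* `GateList.plug gs ρ A` — append a whole circuit `A` (inputs `κ`) behind `gs`, feeding its
  input `k` from the wire `ρ k`: `carries_plug` (value `A (f₀ x, …)`, depth `acDepth A + d`),
  `wf_plug`, `length_plug`, `fn_mem_plug`;
* `GateList.layerL Cs` — lay a list of circuits side by side (`parBlocks`): `carries_layerL`
  (the `k`-th output wire carries `Cs[k]`), `wf_layerL`, `length_layerL`, `fn_mem_layerL`;
* extraction to a `Circuit` (`GateList.toCircuit`): `eval_toCircuit`, `acDepth_toCircuit_le`.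

Everything is proved; no new mathematics (Vollmer 1999, §1.2: composition of circuits, depths
and sizes add).

## References

* H. Vollmer, *Introduction to Circuit Complexity*, Springer 1999, §1.2 [Vollmer1999].
* S. Arora, B. Barak, *Computational Complexity: A Modern Approach*, CUP 2009, Def. 6.1,
  Rem. 6.4 (straight-line programs) [AroraBarak2009].
-/

namespace Literature.Computability.Complexity

namespace GateList

open Finset

variable {ι κ : Type*}

/-! ### Wires carrying functions at bounded depth -/

/-- `Carries gs u f d`: in the straight-line program `gs`, the wire `u` refers to an input or an
existing gate, carries the value `f x` on every input `x`, and has `acWeight`-depth at most `d`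
(the data-level form of `ACRealOver`, with the program explicit; Vollmer 1999, §1.2).
[cite: Vollmer1999, §1.2] -/
structure Carries (gs : List (Gate ι)) (u : ι ⊕ ℕ) (f : (ι → Bool) → Bool) (d : ℕ) : Prop where
  /-- the wire exists -/
  outOK : OutOK gs.length u
  /-- the wire carries `f` -/
  eval : ∀ x, wireOf x (vals gs x) u = f x
  /-- the wire has depth `≤ d` -/
  depth : wireDepthOf (wdepths acWeight gs) u ≤ d

namespace Carries

variable {gs : List (Gate ι)} {u : ι ⊕ ℕ} {f g : (ι → Bool) → Bool} {d d' : ℕ}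

/-- Monotonicity in the depth bound. [folklore] -/
theorem mono (h : Carries gs u f d) (hd : d ≤ d') : Carries gs u f d' :=
  ⟨h.outOK, h.eval, h.depth.trans hd⟩

/-- Extensionality in the carried function. [folklore] -/
theorem congr (h : Carries gs u f d) (hfg : ∀ x, f x = g x) : Carries gs u g d :=
  ⟨h.outOK, fun x => (h.eval x).trans (hfg x), h.depth⟩

/-- **Stability under appending gates**: a wire keeps existence, value and depth when the
program is extended. [folklore] -/
theorem append (h : Carries gs u f d) (more : List (Gate ι)) : Carries (gs ++ more) u f d := by
  refine ⟨fun m hm => (h.outOK m hm).trans_le (by simp), fun x => ?_, ?_⟩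
  · rw [wireOf_append_left x gs more h.outOK, h.eval x]
  · rw [wireDepthOf_wdepths_append acWeight gs more u h.outOK]
    exact h.depth

end Carries

/-- An input wire carries its input bit at depth `0`, in any program. [folklore] -/
theorem carries_input (gs : List (Gate ι)) (i : ι) : Carries gs (Sum.inl i) (fun x => x i) 0 :=
  ⟨fun _ hm => absurd hm Sum.inl_ne_inr, fun _ => rfl, by simp⟩

/-! ### Appending one gate -/

/-- **Appending one gate**: the new wire carries the gate applied to the values of its argument
wires, at depth its weight plus the largest argument depth. [cite: Vollmer1999, §1.2] -/
theorem carries_snoc (gs : List (Gate ι)) (g : Gate ι) {F : (ι → Bool) → Bool} {d : ℕ}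
    (hev : ∀ x, g.op (fun a => wireOf x (vals gs x) (g.args a)) = F x)
    (hdep : acWeight g.fn + univ.sup (fun a => wireDepthOf (wdepths acWeight gs) (g.args a)) ≤ d) :
    Carries (gs ++ [g]) (Sum.inr gs.length) F d := by
  refine ⟨fun m hm => ?_, fun x => ?_, ?_⟩
  · simp only [Sum.inr.injEq] at hm
    subst hm
    simp
  · rw [wireOf_inr, vals_append_singleton, List.getD_eq_getElem?_getD,
      List.getElem?_append_right (by simp), length_vals, Nat.sub_self]
    simpa using hev x
  · rw [wireDepthOf_inr, getD_wdepths_append_singleton]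
    exact hdep

/-- Appending a gate whose argument wires exist keeps the program well formed. [folklore] -/
theorem wf_snoc {gs : List (Gate ι)} (hwf : WF gs) {g : Gate ι}
    (hg : ∀ a, OutOK gs.length (g.args a)) : WF (gs ++ [g]) :=
  hwf.append_singleton fun a m hm => hg a m hm

/-- Gates of `gs ++ [g]`. [folklore] -/
theorem fn_mem_snoc {B : Set GateFn} {gs : List (Gate ι)} {g : Gate ι} (h : ∀ g' ∈ gs, g'.fn ∈ B)
    (hg : g.fn ∈ B) : ∀ g' ∈ gs ++ [g], g'.fn ∈ B := by
  intro g' hg'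
  rw [List.mem_append, List.mem_singleton] at hg'
  rcases hg' with hg' | rfl
  · exact h g' hg'
  · exact hg

/-- Append the binary conjunction of two wires. [cite: Vollmer1999, §1.2] -/
def andWire (gs : List (Gate ι)) (u v : ι ⊕ ℕ) : List (Gate ι) × (ι ⊕ ℕ) :=
  (gs ++ [bigGate true 2 ![u, v]], Sum.inr gs.length)

/-- Append the binary disjunction of two wires. [cite: Vollmer1999, §1.2] -/
def orWire (gs : List (Gate ι)) (u v : ι ⊕ ℕ) : List (Gate ι) × (ι ⊕ ℕ) :=
  (gs ++ [bigGate false 2 ![u, v]], Sum.inr gs.length)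

/-- Append the negation of a wire. [cite: Vollmer1999, §1.2] -/
def notWire (gs : List (Gate ι)) (u : ι ⊕ ℕ) : List (Gate ι) × (ι ⊕ ℕ) :=
  (gs ++ [notGate u], Sum.inr gs.length)

/-- **Conjunction of two carried wires**: depth `+ 1`. [cite: Vollmer1999, §1.2] -/
theorem carries_andWire {gs : List (Gate ι)} {u v : ι ⊕ ℕ} {f g : (ι → Bool) → Bool} {d : ℕ}
    (hu : Carries gs u f d) (hv : Carries gs v g d) :
    Carries (andWire gs u v).1 (andWire gs u v).2 (fun x => f x && g x) (d + 1) := by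
  refine carries_snoc gs _ (fun x => ?_) ?_
  · simp [bigGate, GateFn.and, Fin.forall_fin_two, hu.eval x, hv.eval x]
  · rw [bigGate_fn, if_pos rfl, acWeight_and, add_comm]
    refine Nat.add_le_add_right (Finset.sup_le fun a _ => ?_) 1
    fin_cases a
    · exact hu.depth
    · exact hv.depth

/-- **Disjunction of two carried wires**: depth `+ 1`. [cite: Vollmer1999, §1.2] -/
theorem carries_orWire {gs : List (Gate ι)} {u v : ι ⊕ ℕ} {f g : (ι → Bool) → Bool} {d : ℕ}
    (hu : Carries gs u f d) (hv : Carries gs v g d) :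
    Carries (orWire gs u v).1 (orWire gs u v).2 (fun x => f x || g x) (d + 1) := by
  refine carries_snoc gs _ (fun x => ?_) ?_
  · simp [bigGate, GateFn.or, Fin.exists_fin_two, hu.eval x, hv.eval x]
  · rw [bigGate_fn, if_neg Bool.false_ne_true, acWeight_or, add_comm]
    refine Nat.add_le_add_right (Finset.sup_le fun a _ => ?_) 1
    fin_cases a
    · exact hu.depth
    · exact hv.depth

/-- **Negation of a carried wire**: same depth (negations are free). [cite: Vollmer1999, §1.2] -/
theorem carries_notWire {gs : List (Gate ι)} {u : ι ⊕ ℕ} {f : (ι → Bool) → Bool} {d : ℕ}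
    (hu : Carries gs u f d) : Carries (notWire gs u).1 (notWire gs u).2 (fun x => !f x) d := by
  refine carries_snoc gs _ (fun x => ?_) ?_
  · simp [notGate, hu.eval x]
  · rw [notGate_fn, acWeight_not, zero_add]
    exact Finset.sup_le fun a _ => by simpa [notGate] using hu.depth

/-- Well-formedness of the appenders. [folklore] -/
theorem wf_andWire {gs : List (Gate ι)} (hwf : WF gs) {u v : ι ⊕ ℕ} (hu : OutOK gs.length u)
    (hv : OutOK gs.length v) : WF (andWire gs u v).1 :=
  wf_snoc hwf fun a => by fin_cases a <;> simpa [bigGate]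

/-- Well-formedness of the appenders. [folklore] -/
theorem wf_orWire {gs : List (Gate ι)} (hwf : WF gs) {u v : ι ⊕ ℕ} (hu : OutOK gs.length u)
    (hv : OutOK gs.length v) : WF (orWire gs u v).1 :=
  wf_snoc hwf fun a => by fin_cases a <;> simpa [bigGate]

/-- Well-formedness of the appenders. [folklore] -/
theorem wf_notWire {gs : List (Gate ι)} (hwf : WF gs) {u : ι ⊕ ℕ} (hu : OutOK gs.length u) :
    WF (notWire gs u).1 :=
  wf_snoc hwf fun _ => by simpa [notGate]

/-- The appenders add one gate of `acBasis`. [folklore] -/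
theorem fn_mem_andWire {B : Set GateFn} (hB : acBasis ⊆ B) {gs : List (Gate ι)}
    (h : ∀ g ∈ gs, g.fn ∈ B) (u v : ι ⊕ ℕ) : ∀ g ∈ (andWire gs u v).1, g.fn ∈ B :=
  fn_mem_snoc h (by rw [bigGate_fn, if_pos rfl]; exact hB (and_mem_acBasis 2))

/-- The appenders add one gate of `acBasis`. [folklore] -/
theorem fn_mem_orWire {B : Set GateFn} (hB : acBasis ⊆ B) {gs : List (Gate ι)}
    (h : ∀ g ∈ gs, g.fn ∈ B) (u v : ι ⊕ ℕ) : ∀ g ∈ (orWire gs u v).1, g.fn ∈ B :=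
  fn_mem_snoc h (by rw [bigGate_fn, if_neg Bool.false_ne_true]; exact hB (or_mem_acBasis 2))

/-- The appenders add one gate of `acBasis`. [folklore] -/
theorem fn_mem_notWire {B : Set GateFn} (hB : acBasis ⊆ B) {gs : List (Gate ι)}
    (h : ∀ g ∈ gs, g.fn ∈ B) (u : ι ⊕ ℕ) : ∀ g ∈ (notWire gs u).1, g.fn ∈ B :=
  fn_mem_snoc h (by rw [notGate_fn]; exact hB mem_acBasis_not)

/-- Lengths of the appenders. [folklore] -/
@[simp] theorem length_andWire (gs : List (Gate ι)) (u v : ι ⊕ ℕ) :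
    (andWire gs u v).1.length = gs.length + 1 := by simp [andWire]

/-- Lengths of the appenders. [folklore] -/
@[simp] theorem length_orWire (gs : List (Gate ι)) (u v : ι ⊕ ℕ) :
    (orWire gs u v).1.length = gs.length + 1 := by simp [orWire]

/-- Lengths of the appenders. [folklore] -/
@[simp] theorem length_notWire (gs : List (Gate ι)) (u : ι ⊕ ℕ) :
    (notWire gs u).1.length = gs.length + 1 := by simp [notWire]

/-- Earlier wires survive the appenders (restatements of `Carries.append`). [folklore] -/
theorem Carries.andWire {gs : List (Gate ι)} {w : ι ⊕ ℕ} {f : (ι → Bool) → Bool} {d : ℕ}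
    (h : Carries gs w f d) (u v : ι ⊕ ℕ) : Carries (andWire gs u v).1 w f d := h.append _

/-- Earlier wires survive the appenders. [folklore] -/
theorem Carries.orWire {gs : List (Gate ι)} {w : ι ⊕ ℕ} {f : (ι → Bool) → Bool} {d : ℕ}
    (h : Carries gs w f d) (u v : ι ⊕ ℕ) : Carries (orWire gs u v).1 w f d := h.append _

/-- Earlier wires survive the appenders. [folklore] -/
theorem Carries.notWire {gs : List (Gate ι)} {w : ι ⊕ ℕ} {f : (ι → Bool) → Bool} {d : ℕ}
    (h : Carries gs w f d) (u : ι ⊕ ℕ) : Carries (notWire gs u).1 w f d := h.append _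

/-! ### Plugging a circuit behind a program -/

/-- **Plugging a circuit**: append to `gs` the gates of the circuit `A` (inputs `κ`), relocated
behind `gs` with input `k` fed from the wire `ρ k`; returns the new program and the (shifted)
output wire of `A` (Vollmer 1999, §1.2, composition). [cite: Vollmer1999, §1.2] -/
def plug (gs : List (Gate ι)) (ρ : κ → ι ⊕ ℕ) (A : Circuit κ) : List (Gate ι) × (ι ⊕ ℕ) :=
  (gs ++ A.gates.map (reloc ρ gs.length), shiftWire ρ gs.length A.output)

/-- The program of a plug (definitional). [folklore] -/
theorem plug_fst (gs : List (Gate ι)) (ρ : κ → ι ⊕ ℕ) (A : Circuit κ) :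
    (plug gs ρ A).1 = gs ++ A.gates.map (reloc ρ gs.length) := rfl

/-- A plug adds `|A|` gates. [folklore] -/
@[simp] theorem length_plug (gs : List (Gate ι)) (ρ : κ → ι ⊕ ℕ) (A : Circuit κ) :
    (plug gs ρ A).1.length = gs.length + A.size := by
  simp [plug, Circuit.size]

/-- A plug along existing wires keeps the program well formed. [folklore] -/
theorem wf_plug {gs : List (Gate ι)} (hwf : WF gs) {ρ : κ → ι ⊕ ℕ} (hρ : WiresOK gs.length ρ)
    (A : Circuit κ) : WF (plug gs ρ A).1 :=
  hwf.append_reloc (wf_gates A) hρ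

/-- The gates of a plug are those of `gs` and (relocated) those of `A`. [folklore] -/
theorem fn_mem_plug {B : Set GateFn} {gs : List (Gate ι)} (h : ∀ g ∈ gs, g.fn ∈ B)
    (ρ : κ → ι ⊕ ℕ) {A : Circuit κ} (hA : A.IsOver B) : ∀ g ∈ (plug gs ρ A).1, g.fn ∈ B := by
  intro g hg
  rw [plug_fst, List.mem_append, List.mem_map] at hg
  rcases hg with hg | ⟨g', hg', rfl⟩
  · exact h g hg
  · rw [reloc_fn]
    exact hA g' hg'

/-- **Semantics and depth of a plug**: if the wire `ρ k` carries `f k` at depth `≤ d` for every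
input `k` of `A`, then the output wire of the plug carries `x ↦ A(f₀ x, …)` at depth
`≤ acDepth A + d` (Vollmer 1999, §1.2). [cite: Vollmer1999, §1.2] -/
theorem carries_plug {gs : List (Gate ι)} {ρ : κ → ι ⊕ ℕ} (A : Circuit κ)
    {f : κ → (ι → Bool) → Bool} {d : ℕ} (h : ∀ k, Carries gs (ρ k) (f k) d) :
    Carries (plug gs ρ A).1 (plug gs ρ A).2 (fun x => A.eval fun k => f k x) (A.acDepth + d) := by
  have hρ : WiresOK gs.length ρ := fun k => (h k).outOK
  refine ⟨fun m hm => ?_, fun x => ?_, ?_⟩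
  · rw [length_plug]
    change shiftWire ρ gs.length A.output = Sum.inr m at hm
    cases hout : A.output with
    | inl k =>
      rw [hout] at hm
      exact (hρ k m hm).trans_le (Nat.le_add_right _ _)
    | inr m' =>
      rw [hout] at hm
      simp only [shiftWire, Sum.inr.injEq] at hm
      have := A.wf_output m' hout
      simp only [Circuit.size]
      omega
  · simp only [plug]
    rw [vals_append_reloc gs A.gates ρ hρ x,
      wireOf_shiftWire x (vals gs x) _ (length_vals gs x) ρ hρ A.output, circuit_eval]
    have hx : (fun k => wireOf x (vals gs x) (ρ k)) = fun k => f k x := funext fun k => (h k).eval x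
    rw [hx]
  · obtain ⟨ds', hds', hlen', hle'⟩ :=
      wdepths_append_reloc_le acWeight gs A.gates ρ hρ d fun k => (h k).depth
    simp only [plug]
    rw [hds']
    cases hout : A.output with
    | inl k =>
      simp only [shiftWire]
      rw [wireDepthOf_append_of_lt _ _ (ρ k) (fun m hm => by rw [length_wdepths]; exact hρ k m hm)]
      exact (h k).depth.trans (Nat.le_add_left _ _)
    | inr m' =>
      simp only [shiftWire, wireDepthOf_inr, List.getD_eq_getElem?_getD]
      rw [List.getElem?_append_right (by rw [length_wdepths]; omega), length_wdepths,
        Nat.add_sub_cancel]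
      have h1 := hle' m'
      rw [List.getD_eq_getElem?_getD, List.getD_eq_getElem?_getD] at h1
      refine h1.trans (Nat.add_le_add_right ?_ _)
      have h2 : A.acDepth = wireDepthOf (wdepths acWeight A.gates) A.output :=
        circuit_depthWith A acWeight
      rw [hout, wireDepthOf_inr, List.getD_eq_getElem?_getD] at h2
      rw [← h2]

/-- Earlier wires survive a plug. [folklore] -/
theorem Carries.plug {gs : List (Gate ι)} {w : ι ⊕ ℕ} {f : (ι → Bool) → Bool} {d : ℕ}
    (h : Carries gs w f d) (ρ : κ → ι ⊕ ℕ) (A : Circuit κ) : Carries (GateList.plug gs ρ A).1 w f d :=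
  h.append _

/-! ### A layer of circuits side by side -/

/-- **A layer**: the circuits of the list `Cs` laid side by side (`parBlocks`); returns the
program and the list of their (shifted) output wires. [cite: Vollmer1999, §1.2] -/
def layerL (Cs : List (Circuit ι)) : List (Gate ι) × List (ι ⊕ ℕ) :=
  parBlocks (Cs.map fun C => (C.gates, C.output))

/-- One output wire per circuit. [folklore] -/
@[simp] theorem length_layerL_snd (Cs : List (Circuit ι)) : (layerL Cs).2.length = Cs.length := by
  simp [layerL, length_parBlocks_snd]

/-- The layer has as many gates as its circuits together. [folklore] -/
theorem length_layerL_fst (Cs : List (Circuit ι)) :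
    (layerL Cs).1.length = (Cs.map Circuit.size).sum := by
  rw [layerL, length_parBlocks_fst, List.map_map]
  rfl

/-- The layer is well formed. [folklore] -/
theorem wf_layerL (Cs : List (Circuit ι)) : WF (layerL Cs).1 :=
  wf_parBlocks _ fun b hb => by
    obtain ⟨C, -, rfl⟩ := List.mem_map.1 hb
    exact wf_gates C

/-- The gates of the layer are gates of its circuits. [folklore] -/
theorem fn_mem_layerL {B : Set GateFn} {Cs : List (Circuit ι)} (h : ∀ C ∈ Cs, C.IsOver B) :
    ∀ g ∈ (layerL Cs).1, g.fn ∈ B :=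
  fn_mem_parBlocks _ fun b hb => by
    obtain ⟨C, hC, rfl⟩ := List.mem_map.1 hb
    exact h C hC

/-- **Semantics and depth of a layer**: the `k`-th output wire carries the `k`-th circuit at its
own depth. [cite: Vollmer1999, §1.2] -/
theorem carries_layerL (Cs : List (Circuit ι)) (k : ℕ) (hk : k < Cs.length) {d : ℕ}
    (hd : (Cs[k]).acDepth ≤ d) :
    Carries (layerL Cs).1 ((layerL Cs).2[k]'(by rw [length_layerL_snd]; exact hk)) (Cs[k]).eval d := by
  set bs : List (List (Gate ι) × (ι ⊕ ℕ)) := Cs.map fun C => (C.gates, C.output) with hbs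
  have hbs_len : bs.length = Cs.length := by simp [hbs]
  have hO : ∀ b ∈ bs, OutOK b.1.length b.2 := by
    intro b hb
    obtain ⟨C, -, rfl⟩ := List.mem_map.1 hb
    exact C.wf_output
  have hbsk : bs[k]'(by rw [hbs_len]; exact hk) = ((Cs[k]).gates, (Cs[k]).output) := by
    simp [hbs]
  have hk2 : k < (parBlocks bs).2.length := by rw [length_parBlocks_snd, hbs_len]; exact hk
  refine ⟨?_, fun x => ?_, ?_⟩
  · exact outOK_parBlocks bs hO _ (List.getElem_mem hk2)
  · have := wireOf_parBlocks x bs hO k hk2 (by rw [hbs_len]; exact hk)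
    rw [hbsk] at this
    rw [circuit_eval]
    exact this
  · have := wireDepthOf_parBlocks acWeight bs hO k hk2 (by rw [hbs_len]; exact hk)
    rw [hbsk] at this
    change wireDepthOf (wdepths acWeight (parBlocks bs).1) ((parBlocks bs).2[k]) ≤ d
    rw [this]
    have h2 : (Cs[k]).acDepth = wireDepthOf (wdepths acWeight (Cs[k]).gates) (Cs[k]).output :=
      circuit_depthWith _ acWeight
    rw [← h2]
    exact hd

/-! ### Extraction -/

/-- The circuit extracted from a program computes what its output wire carries. [folklore] -/
theorem eval_toCircuit {gs : List (Gate ι)} (hwf : WF gs) {u : ι ⊕ ℕ} {f : (ι → Bool) → Bool}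
    {d : ℕ} (h : Carries gs u f d) (x : ι → Bool) : (toCircuit gs u hwf h.outOK).eval x = f x := by
  rw [circuit_eval]
  exact h.eval x

/-- The circuit extracted from a program has the depth of its output wire. [folklore] -/
theorem acDepth_toCircuit_le {gs : List (Gate ι)} (hwf : WF gs) {u : ι ⊕ ℕ}
    {f : (ι → Bool) → Bool} {d : ℕ} (h : Carries gs u f d) :
    (toCircuit gs u hwf h.outOK).acDepth ≤ d := by
  change Circuit.depthWith _ acWeight ≤ d
  rw [circuit_depthWith]
  exact h.depth

/-- The circuit extracted from a program has its gates (size and basis). [folklore] -/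
theorem size_toCircuit {gs : List (Gate ι)} (hwf : WF gs) {u : ι ⊕ ℕ} (ho : OutOK gs.length u) :
    (toCircuit gs u hwf ho).size = gs.length := rfl

/-- The circuit extracted from a program over `B` is over `B`. [folklore] -/
theorem isOver_toCircuit {B : Set GateFn} {gs : List (Gate ι)} (hwf : WF gs) {u : ι ⊕ ℕ}
    (ho : OutOK gs.length u) (h : ∀ g ∈ gs, g.fn ∈ B) : (toCircuit gs u hwf ho).IsOver B := h

end GateList

end Literature.Computability.Complexity
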